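import Summits.AnomalousDissipation.AnomalousDissipation.Theorems.BaireTransferRobustLoudUpgradeStubLsFoldPeriodicA
import Summits.AnomalousDissipation.AnomalousDissipation.Theorems.BaireTransferRobustLoudUpgradeStubLsFamilyPeriodic

/-!
# Stub `stub_lsFoldPeriodic` (crux stmt-AnomalousDissipation-1144, companion c3), part B: the FOLD TRANSFER — the second-order term
# `μ_g ∂ₛĝ₁ + B(ĝ₁, ĝ₁)` of a kernel vector of the free-period linearisation is not in the range of `[T | ∂ₛx₀]` when the orbit is a
# transversal fold of cycles (classical, intrinsic hypothesis over all real kernel pairs); `kernel_not_phase` (a kernel vector with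
# vanishing phase is not a multiple of `∂ₜu`); registered abstract ending `lsFoldPeriodic_partB`.  Pure proof file; notations verbatim from
# `PeriodicNSOrbitPersistsProofs`.  Refs: Kielhöfer 2012 §I.12–I.13; Chow–Hale 1982 Ch. 9; Iooss 1972 §3; Henry 1981 Lemma 8.3.1.
-/


-- `Summit.<Summit>.<Problem>` is the tree's mandated summit-side namespace (CONVENTIONS §2); for this
-- single-conjunct summit the two coincide, so the duplicate is deliberate.
set_option linter.dupNamespace false

noncomputable section

open scoped BigOperators Topology ENNReal NNReal ComplexConjugate
open Filter Set Function MeasureTheory UnitAddTorus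

namespace Summit.AnomalousDissipation.AnomalousDissipation.Theorems.RobustLoudUpgrade.LsFamilyPeriodic

open Literature.Analysis.FunctionSpaces Literature.Analysis.FunctionSpaces.Torus
open Literature.Analysis.FunctionSpaces.EuclideanSpace
open Literature.Analysis.FluidPDE
open Literature.Analysis.FluidPDE.ScalarFourier
open Literature.Analysis.FluidPDE.TimePeriodicLattice
open Summit.AnomalousDissipation.AnomalousDissipation.Theses.BaireTransfer

-- NOTATION START (verbatim from `PeriodicNSOrbitPersistsProofs`)
/-- Local notation: the parabolic weight `Λ(n, k) = |n| + |k|²`. -/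
local notation:max "Λ" m:max => (|((Prod.fst m : ℤ) : ℝ)| + freqNormSq (Prod.snd m))

/-- Local notation: the convective symbol on `ℤ × ℤ³` (as in `TimePeriodicNSLattice`). -/
local notation:max "𝐍[" a ", " b "]" m:max =>
  (WithLp.toLp 2 (fun p : Fin 3 => ∑ j : Fin 3, ∑' m' : ℤ × (Fin 3 → ℤ),
    a m' j * (dsym j (Prod.snd m - Prod.snd m') * b (m - m') p)) : EuclideanSpace ℂ (Fin 3))

/-- Local notation: division by the weight. -/
local notation:max "𝐜" x:max => (fun mm : ℤ × (Fin 3 → ℤ) =>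
  ((((|((Prod.fst mm : ℤ) : ℝ)| + freqNormSq (Prod.snd mm))⁻¹ : ℝ) : ℂ) • x mm))

/-- Local notation: multiplication by the weight. -/
local notation:max "𝐬" x:max => (fun mm : ℤ × (Fin 3 → ℤ) =>
  ((((|((Prod.fst mm : ℤ) : ℝ)| + freqNormSq (Prod.snd mm)) : ℝ) : ℂ) • x mm))

/-- Local notation: the family of coefficients of `x ∈ W ⊂ ℓ²`. -/
local notation:max "𝐰" x:max =>
  (((x : lp (fun _ : ℤ × (Fin 3 → ℤ) => EuclideanSpace ℂ (Fin 3)) 2)) : ℤ × (Fin 3 → ℤ) → EuclideanSpace ℂ (Fin 3))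

/-- Local notation: the extension `K ↦ c (K₀, tail K)` of a lattice family to `ℤ⁴`. -/
local notation:max "𝐄" c:max => (fun K : Fin 4 → ℤ => c ((K 0, Fin.tail K) : ℤ × (Fin 3 → ℤ)))

/-- Local notation: the lattice family `û(n,k) = 𝓕(complexify ∘ (U − m₀))(n,k)`. -/
local notation:max "𝐮[" U ", " m₀ "]" => (fun mm : ℤ × (Fin 3 → ℤ) =>
  mFourierCoeff (EuclideanSpace.complexify ∘ fun y : UnitAddTorus (Fin 4) => U y - m₀)
    (Fin.cons (Prod.fst mm) (Prod.snd mm) : Fin 4 → ℤ))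

/-- Local notation: the force family `y_F(n,k) = [k ≠ 0][n = 0] 𝓕(complexify ∘ F)(k)`. -/
local notation:max "𝐲" F:max => (fun mm : ℤ × (Fin 3 → ℤ) =>
  (ite (Prod.snd mm = 0) (0 : EuclideanSpace ℂ (Fin 3))
    (ite (Prod.fst mm = 0) (mFourierCoeff (EuclideanSpace.complexify ∘ F) (Prod.snd mm)) 0)))

/-- Local notation: the lattice family of the orbit `u` with period `τ`. -/
local notation:max "𝐨[" τ ", " u "]" => (fun mm : ℤ × (Fin 3 → ℤ) =>
  mFourierCoeff (EuclideanSpace.complexify ∘ fun y : UnitAddTorus (Fin 4) => Torus.timeRoll τ u y - ∫ x, u 0 x)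
    (Fin.cons (Prod.fst mm) (Prod.snd mm) : Fin 4 → ℤ))
/-- Local notation: the time multiplier `dₛ(n,k) = 2πi n / Λ(n,k)`. -/
local notation "dS" => (fun mm : ℤ × (Fin 3 → ℤ) =>
  (2 * Real.pi * Complex.I * ((Prod.fst mm : ℤ) : ℂ)) * ((((|((Prod.fst mm : ℤ) : ℝ)| + freqNormSq (Prod.snd mm)) : ℝ) : ℂ))⁻¹)

/-- Local notation: the Stokes–drift multiplier `(4π²ν|k|² + 2πi m₀·k) / Λ(n,k)`. -/
local notation "dL[" ν ", " m₀ "]" => (fun mm : ℤ × (Fin 3 → ℤ) =>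
  (((4 * Real.pi ^ 2 * ν * freqNormSq (Prod.snd mm) : ℝ) : ℂ) +
      2 * Real.pi * Complex.I * (∑ jj : Fin 3, ((m₀ jj : ℝ) : ℂ) * (((Prod.snd mm) jj : ℤ) : ℂ))) *
    ((((|((Prod.fst mm : ℤ) : ℝ)| + freqNormSq (Prod.snd mm)) : ℝ) : ℂ))⁻¹)

/-- Local notation: the symbol `σ_om(n,k) = 2πiomn + 4π²ν|k|² + 2πi m₀·k`. -/
local notation "σ[" om ", " ν ", " m₀ "]" => (fun mm : ℤ × (Fin 3 → ℤ) =>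
  2 * Real.pi * Complex.I * ((om : ℝ) : ℂ) * ((Prod.fst mm : ℤ) : ℂ) +
    (((4 * Real.pi ^ 2 * ν * freqNormSq (Prod.snd mm) : ℝ)) : ℂ) +
    2 * Real.pi * Complex.I * (∑ jj : Fin 3, ((m₀ jj : ℝ) : ℂ) * (((Prod.snd mm) jj : ℤ) : ℂ)))
-- NOTATION END

variable {W : Submodule ℝ (lp (fun _ : ℤ × (Fin 3 → ℤ) => EuclideanSpace ℂ (Fin 3)) 2)}

/-! ## §1 The fold transfer -/

section FoldTransfer

variable {ν τ : ℝ} {f : UnitAddTorus (Fin 3) → EuclideanSpace ℝ (Fin 3)}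
  {u v : ℝ → UnitAddTorus (Fin 3) → EuclideanSpace ℝ (Fin 3)} {p : ℝ → UnitAddTorus (Fin 3) → ℝ}

variable (hW : ∀ x : lp (fun _ : ℤ × (Fin 3 → ℤ) => EuclideanSpace ℂ (Fin 3)) 2, x ∈ W ↔
      (∀ n : ℤ, (x : ℤ × (Fin 3 → ℤ) → EuclideanSpace ℂ (Fin 3)) (n, 0) = 0) ∧
      (∀ mm : ℤ × (Fin 3 → ℤ), (∑ jj : Fin 3, ((mm.2 jj : ℤ) : ℂ) *
        ((x : ℤ × (Fin 3 → ℤ) → EuclideanSpace ℂ (Fin 3)) mm) jj) = 0) ∧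
      (∀ mm : ℤ × (Fin 3 → ℤ), (x : ℤ × (Fin 3 → ℤ) → EuclideanSpace ℂ (Fin 3)) (-mm) =
        conjVec ((x : ℤ × (Fin 3 → ℤ) → EuclideanSpace ℂ (Fin 3)) mm)))
variable {Ds L₀ : W →L[ℝ] W} (hDs : ∀ (x : W) (m : ℤ × (Fin 3 → ℤ)), (𝐰 (Ds x)) m = dS m • (𝐰 x) m)
  (hL₀ : ∀ (x : W) (m : ℤ × (Fin 3 → ℤ)), (𝐰 (L₀ x)) m = dL[ν, ∫ x, u 0 x] m • (𝐰 x) m)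
variable {B : W → W → W} (hBf : ∀ (x y : W) (m : ℤ × (Fin 3 → ℤ)), (𝐰 (B x y)) m = Torus.lerayCoeff m.2 (𝐍[𝐜 (𝐰 x), 𝐜 (𝐰 y)] m))

include hW in
/-- **A kernel vector with vanishing phase is not a multiple of the phase direction.**  If `k ∈ W` has rapidly decaying `k/Λ`,
`φ k = 0` for a functional with `φ g ≠ 0`, and the unrolled synthesis of `k/Λ` is `z ∂ₜu`, then `k = 0`. [folklore] -/
theorem kernel_not_phase (hτ : 0 < τ) (hsu : IsSmoothSpaceTimeOn univ u) (hper : Function.Periodic u τ)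
    (g : W) (hg : 𝐰 g = fun mm : ℤ × (Fin 3 → ℤ) => (2 * Real.pi * Complex.I * (mm.1 : ℂ)) • (𝐬 (𝐨[τ, u])) mm)
    (hg0 : g ≠ 0) (φ : W →L[ℝ] ℝ) (hφ : φ g ≠ 0) (k : W) (hhr : RapidDecay (𝐄 (𝐜 (𝐰 k)))) (hφk : φ k = 0) {z : ℂ}
    (hz : ∀ t x, fourierSynth (𝐄 (𝐜 (𝐰 k))) (Fin.cons (((τ⁻¹ * t : ℝ)) : UnitAddCircle) x) =
      z • Torus.realToComplex (Torus.timeDerivWithin univ u t x)) : k = 0 := by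
  have hcoe := coe_eq_smul_phase_of_synth_eq hW hτ hsu hper g hg k hhr hz
  set c₁ : ℂ := z * ((τ⁻¹ : ℝ) : ℂ) with hc₁
  -- reality of `c₁` (or `g = 0`)
  obtain ⟨m₀, hm₀⟩ : ∃ m, (𝐰 g) m ≠ 0 := by
    by_contra hall
    push Not at hall
    exact hg0 (W_ext fun m => by rw [hall m, coeW_zero, Pi.zero_apply])
  have hreal : conj c₁ = c₁ := by
    have h1 := W_conj hW k m₀
    rw [hcoe (-m₀), hcoe m₀, W_conj hW g m₀, conjVec_smul] at h1
    have h2 : (c₁ - conj c₁) • conjVec ((𝐰 g) m₀) = 0 := by rw [sub_smul, h1, sub_self]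
    rcases smul_eq_zero.1 h2 with h3 | h3
    · exact (sub_eq_zero.1 h3).symm
    · have : (𝐰 g) m₀ = 0 := by simpa [conjVec_conjVec, conjVec_zero] using congrArg conjVec h3
      exact absurd this hm₀
  have hk : k = c₁.re • g := by
    refine W_ext fun m => ?_
    rw [hcoe m, coeW_smul, Pi.smul_apply, ← Complex.coe_smul]
    congr 1
    exact (Complex.conj_eq_iff_re.1 hreal).symm
  have hre : c₁.re = 0 := by
    have h1 := hφk; rw [hk, map_smul, smul_eq_mul] at h1
    rcases mul_eq_zero.1 h1 with h2 | h2
    · exact h2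
    · exact absurd h2 hφ
  rw [hk, hre, zero_smul]

set_option maxHeartbeats 800000 in
include hW hDs hL₀ hBf in
/-- **The fold transfer.**  Let `(k, μk) ≠ 0` be a kernel pair of the free-period linearisation (`T k + μk ∂ₛx₀ = 0`) whose field is not a
multiple of `∂ₜu`.  Under the INTRINSIC transversality hypothesis — for every real kernel pair `(w, β')` (a real smooth `τ`-periodic solution
of the linearised problem forced by `β' ∂ₜu`, not a multiple of `∂ₜu`) the problem forced by `β ∂ₜu + [(w·∇)w − β' ∂ₜw]` has no periodic
solution — the second-order vector `μk ∂ₛk + B(k, k)` is not of the form `T h + μ ∂ₛx₀` (forced linear dictionary applied to the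
second-order field of `kernelField`/`secondOrderField`). [folklore] -/
theorem fold_transfer (hν : 0 < ν) (hτ : 0 < τ) (hsol : Torus.IsClassicalNSSolutionOn univ ν (fun _ => f) u p)
    (hper : Function.Periodic u τ) (hf0 : HasZeroMean f) (x₀ : W) (hx₀ : 𝐰 x₀ = 𝐬 (𝐨[τ, u]))
    (hfold : ∀ (wr : ℝ → UnitAddTorus (Fin 3) → EuclideanSpace ℝ (Fin 3)) (β' : ℝ),
      IsSmoothSpaceTimeOn univ wr → Function.Periodic wr τ →
      (fun t x => Torus.realToComplex (wr t x)) ∈ linPeriodicSol ν u τ (fun t x => (β' : ℂ) • velocityDot u t x) →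
      (¬ ∃ z : ℂ, ∀ t x, Torus.realToComplex (wr t x) = z • velocityDot u t x) →
      ∀ β : ℂ, linPeriodicSol ν u τ (fun t x => β • velocityDot u t x +
        Torus.realToComplex (Torus.convect (wr t) (wr t) x - β' • Torus.timeDerivWithin univ wr t x)) = ∅)
    (k : W) (μk : ℝ) (hkeq : τ⁻¹ • Ds k + L₀ k + (B x₀ k + B k x₀) = (-μk) • Ds x₀)
    (hkn : ¬ ∃ z : ℂ, ∀ t x, fourierSynth (𝐄 (𝐜 (𝐰 k))) (Fin.cons (((τ⁻¹ * t : ℝ)) : UnitAddCircle) x) =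
      z • Torus.realToComplex (Torus.timeDerivWithin univ u t x))
    (h : W) (μ : ℝ) : τ⁻¹ • Ds h + L₀ h + (B x₀ h + B h x₀) ≠ (-μ) • Ds x₀ + (μk • Ds k + B k k) := by
  intro heqW
  have hU : IsSmooth (timeRoll τ u) := orbit_isSmooth hsol hper
  have hu0 := orbit_zero_modes hsol hper hf0
  have hut := orbit_transversal hsol hper
  -- §a the kernel field and its multiplier
  obtain ⟨hhr₁, hWs, hreal, hcoefW, hws, hwper, hwmem⟩ := kernelField hW hDs hL₀ hBf hν hτ hsol hper hf0 x₀ hx₀ k μk hkeq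
  set Wg : UnitAddTorus (Fin 4) → EuclideanSpace ℝ (Fin 3) := fun y => EuclideanSpace.realPart (fourierSynth (𝐄 (𝐜 (𝐰 k))) y) with hWg
  set wg : ℝ → UnitAddTorus (Fin 3) → EuclideanSpace ℝ (Fin 3) :=
    fun t x => Wg (Fin.cons (((τ⁻¹ * t : ℝ)) : UnitAddCircle) x) with hwg
  have hroll : timeRoll τ wg = Wg := by
    have := timeRoll_comp_cons Wg (inv_ne_zero hτ.ne')
    rwa [inv_inv] at this
  have hk0 : ∀ n : ℤ, (𝐜 (𝐰 k)) (n, 0) = 0 := cw_zero_mode (W_zero hW k)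
  have hkt : ∀ mm : ℤ × (Fin 3 → ℤ), (∑ jj : Fin 3, ((mm.2 jj : ℤ) : ℂ) * ((𝐜 (𝐰 k)) mm) jj) = 0 := cw_transversal (W_trans hW k)
  -- §b the second-order field
  obtain ⟨hHs, hH0, hHcoef⟩ := secondOrderField (Wr := Wg) hWs hcoefW hk0 hkt hhr₁ μk
  set Hc : UnitAddTorus (Fin 4) → EuclideanSpace ℂ (Fin 3) := fun y => (μk : ℂ) • (complexify ∘ Torus.partialDeriv 0 Wg) y +
      ∑ j : Fin 3, ((complexify ∘ Wg) y) j • Torus.partialDeriv (Fin.succ j) (complexify ∘ Wg) y with hHc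
  -- §c the right-hand side on the lattice
  have hYQ : ∀ m : ℤ × (Fin 3 → ℤ), (𝐰 ((μk • Ds k + B k k : W))) m = Torus.lerayCoeff m.2 (mFourierCoeff Hc (Fin.cons m.1 m.2)) := by
    intro m
    by_cases hm : m.2 = 0
    · rw [W_zero' hW _ hm]
      have : mFourierCoeff Hc (Fin.cons m.1 m.2) = 0 := by
        have := hH0 m.1; rwa [show (Fin.cons m.1 (0 : Fin 3 → ℤ) : Fin 4 → ℤ) = Fin.cons m.1 m.2 by rw [hm]] at this
      rw [this, SteadyLattice.lerayCoeff_zero_vec]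
    · rw [hHcoef m, SteadyLattice.lerayCoeff_add', coeW_add, Pi.add_apply, coeW_smul, Pi.smul_apply, hDs, hBf,
        SteadyLattice.lerayCoeff_of_kdot_eq_zero hm (by
          rw [SteadyLattice.kdot_smul, SteadyLattice.kdot_smul, hkt m, mul_zero, mul_zero] :
          (∑ jj : Fin 3, ((m.2 jj : ℤ) : ℂ) * (((μk : ℂ) • ((2 * Real.pi * Complex.I * (m.1 : ℂ)) • (𝐜 (𝐰 k)) m)) jj)) = 0)]
      congr 1
      rw [← Complex.coe_smul]
      simp only [smul_smul]
      have hL : ((((Λ m)) : ℝ) : ℂ) ≠ 0 := by exact_mod_cast ne_of_gt (lt_of_lt_of_le one_pos (one_le_wt hm))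
      congr 1
      rw [Complex.ofReal_inv]
  have hY : ∀ m, (𝐰 (((-μ) • Ds x₀ + (μk • Ds k + B k k) : W))) m =
      ((-μ : ℝ) : ℂ) • ((2 * Real.pi * Complex.I * (m.1 : ℂ)) • 𝐨[τ, u] m) + Torus.lerayCoeff m.2 (mFourierCoeff Hc (Fin.cons m.1 m.2)) :=
    fun m => by rw [coeW_add, Pi.add_apply, coe_smul_Ds_orbit hDs hsol hper hf0 x₀ hx₀ (-μ) m, hYQ, Complex.ofReal_neg]
  -- moments of the inhomogeneity family
  have hHr : RapidDecay (mFourierCoeff Hc) := hHs.rapidDecay_mFourierCoeff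
  have hH0' : ∀ n : ℤ, (fun mm : ℤ × (Fin 3 → ℤ) => mFourierCoeff Hc (Fin.cons mm.1 mm.2)) (n, 0) = 0 := fun n => hH0 n
  have hyH : ∀ N : ℕ, ∑' m : ℤ × (Fin 3 → ℤ), ENNReal.ofReal ((Λ m) ^ N) *
      ‖Torus.lerayCoeff m.2 (mFourierCoeff Hc (Fin.cons m.1 m.2))‖ₑ ^ 2 ≠ ⊤ := by
    intro N
    have h1 := moments_of_rapidDecay (C := mFourierCoeff Hc) hHr N
    refine ne_top_of_le_ne_top h1 (ENNReal.tsum_le_tsum fun m => ?_)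
    gcongr
    calc ‖Torus.lerayCoeff m.2 (mFourierCoeff Hc (Fin.cons m.1 m.2))‖ₑ ≤ ‖mFourierCoeff Hc (Fin.cons m.1 m.2)‖ₑ := by
          rw [← ofReal_norm, ← ofReal_norm]
          exact ENNReal.ofReal_le_ofReal (SteadyLattice.norm_lerayCoeff_le _ _)
      _ ≤ ‖(𝐬 (fun mm : ℤ × (Fin 3 → ℤ) => mFourierCoeff Hc (Fin.cons mm.1 mm.2))) m‖ₑ :=
          enorm_le_enorm_sw (x := fun mm : ℤ × (Fin 3 → ℤ) => mFourierCoeff Hc (Fin.cons mm.1 mm.2)) hH0' m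
  -- §d the forced dictionary
  obtain ⟨heq, hhr⟩ := linear_core_forced hW hDs hL₀ hBf hν hτ hsol hper hf0 x₀ hx₀ h ((-μ) • Ds x₀ + (μk • Ds k + B k k))
    (b := ((-μ : ℝ) : ℂ)) (yH := fun mm : ℤ × (Fin 3 → ℤ) => Torus.lerayCoeff mm.2 (mFourierCoeff Hc (Fin.cons mm.1 mm.2))) hyH hY heqW
  have hh0 : ∀ n : ℤ, (𝐜 (𝐰 h)) (n, 0) = 0 := cw_zero_mode (W_zero hW h)
  have hht : ∀ mm : ℤ × (Fin 3 → ℤ), (∑ jj : Fin 3, ((mm.2 jj : ℤ) : ℂ) * ((𝐜 (𝐰 h)) mm) jj) = 0 := cw_transversal (W_trans hW h)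
  obtain ⟨Q, hQ, hE⟩ := linear_rolledUp_of_coeff_forced (U := timeRoll τ u) (m₀ := ∫ x, u 0 x) (h := 𝐜 (𝐰 h))
    (b := ((-μ : ℝ) : ℂ)) (Hc := Hc) hU hu0 hut hh0 hht hhr hHs hH0 heq
  obtain ⟨hsw, hsq, hdivC, hmeanC, hperw, hEq⟩ := linear_classical_forced (ν := ν) hτ hsol.smooth_velocity hper
    hhr.isSmooth_fourierSynth hQ hE (div_synth_eq_zero (h := 𝐜 (𝐰 h)) hht hhr)
    (integral_timeSlice_synth_eq_zero (h := 𝐜 (𝐰 h)) hh0 hhr)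
  -- §e unrolling the second-order field: `Hc(t/τ, x) = μk τ ∂ₜw_g + (w_g·∇)w_g`
  have hunroll : ∀ t x, Hc (Fin.cons (((τ⁻¹ * t : ℝ)) : UnitAddCircle) x) =
      Torus.realToComplex (Torus.convect (wg t) (wg t) x - ((-μk) * τ) • Torus.timeDerivWithin univ wg t x) := by
    intro t x
    have hs : τ * (τ⁻¹ * t) = t := by field_simp
    have h0 := partialDeriv_zero_timeRoll hws hwper (τ⁻¹ * t) x
    rw [hroll, hs] at h0
    have hsl : timeSlice Wg (((τ⁻¹ * t : ℝ)) : UnitAddCircle) = wg t := by rw [← hroll, timeSlice_timeRoll hwper, hs]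
    have hWc : IsSmooth (complexify ∘ Wg) := hWs.comp_clm complexify.toContinuousLinearMap
    have hconv : (∑ j : Fin 3, ((complexify ∘ Wg) (Fin.cons (((τ⁻¹ * t : ℝ)) : UnitAddCircle) x)) j •
        Torus.partialDeriv (Fin.succ j) (complexify ∘ Wg) (Fin.cons (((τ⁻¹ * t : ℝ)) : UnitAddCircle) x)) =
        complexify (Torus.convect (wg t) (wg t) x) := by
      rw [← hsl, convect_timeSlice (V := Wg) hWs, map_sum]
      refine Finset.sum_congr rfl fun j _ => ?_
      have hd : Torus.partialDeriv (Fin.succ j) (complexify ∘ Wg) (Fin.cons (((τ⁻¹ * t : ℝ)) : UnitAddCircle) x) =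
          complexify (Torus.partialDeriv (Fin.succ j) Wg (Fin.cons (((τ⁻¹ * t : ℝ)) : UnitAddCircle) x)) := by
        have h1 := partialDeriv_clm_comp hWs complexify.toContinuousLinearMap (Fin.succ j) (Fin.cons (((τ⁻¹ * t : ℝ)) : UnitAddCircle) x)
        simpa only [LinearIsometry.coe_toContinuousLinearMap] using h1
      rw [hd, Function.comp_apply, complexify_apply, Complex.coe_smul, LinearIsometry.map_smul]
    simp only [hHc]
    rw [hconv, Function.comp_apply, h0, LinearIsometry.map_smul, SteadyLattice.realToComplex_eq_complexify, map_sub,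
      LinearIsometry.map_smul, ← Complex.coe_smul τ, smul_smul, neg_mul, neg_smul, sub_neg_eq_add, add_comm]
    congr 1
    rw [← Complex.coe_smul, Complex.ofReal_mul]
  -- §f the classical solution contradicts the intrinsic transversality hypothesis
  have hmem : (fun t : ℝ => fun x : UnitAddTorus (Fin 3) => fourierSynth (𝐄 (𝐜 (𝐰 h))) (Fin.cons (((τ⁻¹ * t : ℝ)) : UnitAddCircle) x)) ∈
      linPeriodicSol ν u τ (fun t x => ((((-μ : ℝ) : ℂ) * (τ : ℂ))) • velocityDot u t x +
        Torus.realToComplex (Torus.convect (wg t) (wg t) x - ((-μk) * τ) • Torus.timeDerivWithin univ wg t x)) := by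
    refine ⟨hsw, hdivC, hmeanC, hperw, _, hsq, fun t x => ?_⟩
    rw [hEq t x, hunroll t x, add_assoc]
    rfl
  have hkn' : ¬ ∃ z : ℂ, ∀ t x, Torus.realToComplex (wg t x) = z • velocityDot u t x := by
    rintro ⟨z, hz⟩
    refine hkn ⟨z, fun t x => ?_⟩
    have h1 := hz t x
    have h2 := congrArg (fun F : UnitAddTorus (Fin 4) → EuclideanSpace ℂ (Fin 3) => F (Fin.cons (((τ⁻¹ * t : ℝ)) : UnitAddCircle) x)) hreal
    simp only [Function.comp_apply] at h2
    rw [← h2, ← SteadyLattice.realToComplex_eq_complexify]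
    exact h1
  have hempty := hfold wg ((-μk) * τ) hws hwper (by
    have := hwmem
    simp only [Complex.ofReal_mul, Complex.ofReal_neg] at this ⊢
    exact this) hkn' ((((-μ : ℝ) : ℂ) * (τ : ℂ)))
  rw [Set.eq_empty_iff_forall_notMem] at hempty
  exact hempty _ hmem

end FoldTransfer

/-! ## Registered part B (abstract, notation-free): scaling of the fold coefficient -/

section Abstract

/-- **Registered sub-goal `lsFoldPeriodic_partB`** (companion c3): the fold coefficient scales quadratically along the kernel line —
`ψ (B̂ (z•g) (z•g)) = z² ψ (B̂ g g)`, so it is non-zero at every non-zero multiple once it is non-zero at `g`. [folklore] -/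
theorem lsFoldPeriodic_partB : ∀ (X Y : Type) [NormedAddCommGroup X] [NormedSpace ℝ X] [NormedAddCommGroup Y] [NormedSpace ℝ Y] (Bh : X →L[ℝ] X →L[ℝ] Y) (ψ : Y →L[ℝ] ℝ) (g : X) (z : ℝ), z ≠ 0 → ψ (Bh g g) ≠ 0 → ψ (Bh (z • g) (z • g)) ≠ 0 := by
  intro X Y _ _ _ _ Bh ψ g z hz hψ
  have h1 : Bh (z • g) (z • g) = (z * z) • Bh g g := by
    rw [Bh.map_smul, smul_apply, map_smul, smul_smul]
  rw [h1, map_smul, smul_eq_mul]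
  exact mul_ne_zero (mul_ne_zero hz hz) hψ

end Abstract

end Summit.AnomalousDissipation.AnomalousDissipation.Theorems.RobustLoudUpgrade.LsFamilyPeriodic

end
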